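import Literature.MathematicalPhysics.QuantumFieldTheory.Balaban1983to89.B6Ineq2118TwoScaleV1
import Literature.MathematicalPhysics.QuantumFieldTheory.Balaban1983to89.B6Eq2146TwoScale

/-!
# `Balaban1983to89.B6Ineq2147TwoScaleV1` — T. Bałaban, *Propagators and renormalization transformations for lattice gauge
# theories. II*, Commun. Math. Phys. **96** (1984) 223–250 [Balaban1984PropagatorsII], p. 248 (2.146)–(2.147): **the covariance
# `C̃^{(j)}_Λ` "is bounded from below by an inverse of an upper bound" of the form (2.120) — FOR THE CONCRETE TWO-SCALE DATA `tsV1`,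
# WITH THE UPPER BOUND SUPPLIED** (`…B6Ineq2118TwoScaleV1` + `Σ_c|(Q₁B)(c)|² ≤ L^{−d}‖B‖²`), and (2.147) reduced to its last printed step

statement-level skeleton of published theorems with citation tags; proofs where landed; nothing here is a claim about the Yang–Mills mass gap

PDF held: `paper:balaban1984-cmp96-propagators-rt-ii` (journal page = PDF page + 222; p. 248 [PDF 26], materialised text
`~/.lit/texts/…-rt-ii/p0026.txt`, this session); [Balaban1984PropagatorsI] (1.11) p. 19 for `Q` (text layer).

PRINT (verbatim, p. 248).  *"From the definition of H_j we have Q_jH_j = I, hence ⟨B, QGQ*B⟩ = ⟨Q″*B, C̃^{(j)}_ΛQ″*B⟩ = ⟨B₁, C̃^{(j)}_ΛB₁⟩, (2.146)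
where B₁ is equal to Q″*B everywhere except the bonds of ⋃_{y∈Λ′}Ax(y) at which it is equal to 0. The operator C̃^{(j)}_Λ is an inverse to
the operator of the quadratic form (2.120), hence it is bounded from below by an inverse of an upper bound of this form. Taking into account
that ‖B₁‖² is bounded from below by const‖B‖², we get ⟨B, (QG^ξ_□Q*)↾_□B⟩ ≧ γ₀‖B‖² (2.147) with a positive constant γ₀ depending on d and
L only."*  [B5] (1.11) p. 19: *"(QA)(c) = Σ_{x∈B(c₋)} L^{−(d+1)}A([x, x(c)])"*.

CITATION HEADER (lean-in-tree rule) — WHAT IS REPRODUCED.  Phase-2 file of the `lit-balaban` typed skeleton (HOME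
`run/shared/lean/pub/lit-balaban/`), seat **p22 gen 10** (B6 fold owner r03, referee ref-4; lane = the Sect. C chain (2.95)–(2.147) on the
concrete two-scale data).  SKELETON rows **B6.Txt@246** / **B6.Eq2.144** ((2.144)–(2.147); decls of record: gen 3's abstract
`…B6Eq2144.inner_cov_ge`/`ineq2147_of_2129`/`ineq2147_printed` with the DISPLAYED hypotheses `hupper` (upper bound of the form (2.120) on
the constraint configurations) and `hB1` (*"‖B₁‖² is bounded from below by const‖B‖²"*); gen 8's `…B6Eq2146TwoScale.eq2146_printed(_V1)`
= (2.146) for the DERIVED operators of `…B6SectCOperators.TwoScaleData` and for `tsV1` — all untouched), FOR THE CONCRETE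
`D = tsV1 hc Λ′ w` of `…B6SectCTwoScaleV1Lattice` (fine torus `T^{(0)}` with factor `c ≠ 0`, unit lattice `T^{(j)}`, `j + 1 ≤ m + K`,
`Λ′ ⊂ T^{(j+1)}`, weights `0 < w ≤ W`):
* §1 (generic, gen 8's covariance `covOp K S = ι(ι*Sι)⁻¹ι*` of `…B6CovarianceOperator`): **`S ≤ U` on `K` ⇒ `⟨k, Ck⟩ ≥ U⁻¹‖k‖²` on `K`**
  (`inner_covOp_ge_of_le`) and the `B₁` mechanism `⟨v, Cv⟩ = ⟨P_Kv, C P_Kv⟩ ≥ U⁻¹‖P_Kv‖²` (`inner_covOp_eq_proj`, `inner_covOp_ge_proj`,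
  `P_K` the orthogonal projection); for `TwoScaleData`: **`C̃^{(j)}_Λ ≥ U⁻¹` on the axial `B` from `Q″*aQ″ + Δ_j ≤ U` there** (`inner_Ct_ge_of_Sb_le`)
  and **`⟨B, QGQ*B⟩ ≥ U⁻¹‖P_{Ax}Q″*B‖²`** (`ineq2147_of_Sb_le`, via gen 8's (2.146)), `ineq2147_of_Sb_le_of_B1` (with `hB1` displayed);
* §2 (V1 calculus, one level, [B5] (1.11)): **`Σ_c |(Q₁B)(c)|² ≤ L^{−d}‖B‖²`** (`sum_bondAvg_sq_le`: Jensen per coarse bond, the blocks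
  partition `T^{(j)}`, translation invariance of `Σ_x`);
* §3 (`tsV1`): `⟨Q″B, aQ″B⟩ ≤ W(1 + L^{−d})‖B‖²` (`inner_Qpp_a_le`), so with `…B6Ineq2118TwoScaleV1.inner_Sb_le_V1` **the form (2.120) is
  `≤ U‖B‖²`, `U = W(1 + L^{−d}) + 8dγ₁κ`** (`inner_Sb_le_V1_unif`; `κ = c²/(η^d L^{2j})`, `γ₁ = (π²/4)^{d+2}`), **`C̃^{(j)}_Λ ≥ U⁻¹` on the axial
  `B` UNCONDITIONALLY** (`inner_Ct_ge_V1` — gen 3's `hupper` DISCHARGED for the concrete model), and **`⟨B, QGQ*B⟩ ≥ U⁻¹‖P_{Ax}Q″*B‖²`**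
  (`ineq2147_V1_B1`) — (2.147) for `tsV1` up to the single printed step *"‖B₁‖² is bounded from below by const‖B‖²"* (gen 3's `hB1`, kept
  displayed in `ineq2147_V1_of_B1`, NOT proved here: it is a combinatorial statement about the block axial trees and `Q″*`, row B6.Eq2.120 (2.121)).
THEOREMS ONLY (no definition, no `def … : Prop`, nothing is a named unproved fact; standard axioms).  HONEST SCOPE: finite-dimensional `ℓ²`
model; `B₁` is typed as the ORTHOGONAL PROJECTION of `Q″*B` onto the axial subspace (print: the coordinate restriction off the tree bonds —
the same thing once the axial subspace is identified with a coordinate subspace, not done here); constants OURS; NOT summit progress.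
-/

noncomputable section

open scoped InnerProductSpace BigOperators

namespace Literature.MathematicalPhysics.QuantumFieldTheory.Balaban1983to89.B6Ineq2147TwoScaleV1

/-! ## §1  Generic: a covariance is bounded below by the inverse of an upper bound of its form -/

section Cov

open B6CovarianceOperator

variable {V : Type*} [NormedAddCommGroup V] [InnerProductSpace ℝ V] [FiniteDimensional ℝ V]

/-- **p. 248 *"The operator C̃ is an inverse to the operator of the quadratic form, hence it is bounded from below by an inverse of an upper
bound of this form"***: for the covariance `C = ι(ι*Sι)⁻¹ι*` of a form `S` symmetric and positive on `K` with `⟨k, Sk⟩ ≤ U‖k‖²` on `K`,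
`U⁻¹‖k‖² ≤ ⟨k, Ck⟩` for every `k ∈ K` (expand `0 ≤ ⟨k − U·Ck, S(k − U·Ck)⟩`). [cite: Balaban1984PropagatorsII, p.248 (text after (2.146))] -/
theorem inner_covOp_ge_of_le (K : Submodule ℝ V) (S : V →ₗ[ℝ] V) (hS : ∀ x y : V, ⟪S x, y⟫_ℝ = ⟪x, S y⟫_ℝ)
    (hpos : ∀ k : ↥K, k ≠ 0 → 0 < ⟪(k : V), S k⟫_ℝ) {U : ℝ} (hU : 0 < U)
    (hup : ∀ k : ↥K, ⟪(k : V), S k⟫_ℝ ≤ U * ‖(k : V)‖ ^ 2) (k : ↥K) :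
    U⁻¹ * ‖(k : V)‖ ^ 2 ≤ ⟪(k : V), covOp K S k⟫_ℝ := by
  set c : ↥K := covOpT K S k with hc
  have hcov : covOp K S k = (c : V) := rfl
  have hsol : ∀ k' : ↥K, ⟪(k' : V), S c⟫_ℝ = ⟪(k' : V), (k : V)⟫_ℝ := fun k' => covOp_sol K S hpos k' k
  have h1 : ⟪(k : V), S c⟫_ℝ = ‖(k : V)‖ ^ 2 := by rw [hsol, real_inner_self_eq_norm_sq]
  have h2 : ⟪(c : V), S k⟫_ℝ = ‖(k : V)‖ ^ 2 := by rw [← hS, real_inner_comm, h1]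
  have h3 : ⟪(c : V), S c⟫_ℝ = ⟪(k : V), (c : V)⟫_ℝ := by rw [hsol c, real_inner_comm]
  have h0 : 0 ≤ ⟪((k - U • c : ↥K) : V), S ((k - U • c : ↥K) : V)⟫_ℝ := by
    by_cases hd : k - U • c = 0
    · rw [hd, Submodule.coe_zero, inner_zero_left]
    · exact (hpos _ hd).le
  rw [Submodule.coe_sub, Submodule.coe_smul, map_sub, map_smul, inner_sub_left, inner_sub_right, inner_sub_right,
    real_inner_smul_right, real_inner_smul_left, real_inner_smul_left, real_inner_smul_right, h1, h2, h3] at h0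
  have h4 := hup k
  rw [hcov, inv_mul_le_iff₀ hU]
  exact le_of_mul_le_mul_left (by linarith) hU

/-- the `K`-valued factor of the covariance sees only the projection onto `K`: `(ι*Sι)⁻¹ι*v = (ι*Sι)⁻¹ι*(P_Kv)`.
[cite: Balaban1984PropagatorsII, (2.146) p.248] -/
theorem covOpT_starProjection (K : Submodule ℝ V) (S : V →ₗ[ℝ] V) (v : V) :
    covOpT K S v = covOpT K S (K.starProjection v) := by
  unfold covOpT
  simp only [LinearMap.coe_comp, Function.comp_apply]
  congr 1
  apply ext_inner_left ℝ
  intro k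
  rw [LinearMap.adjoint_inner_right, LinearMap.adjoint_inner_right, Submodule.coe_subtype]
  have h := Submodule.starProjection_inner_eq_zero v (k : V) k.2
  rw [inner_sub_left, sub_eq_zero] at h
  rw [real_inner_comm v (k : V), h]
  exact real_inner_comm _ _

/-- **the `B₁` mechanism of (2.146)**: `⟨v, Cv⟩ = ⟨P_Kv, C(P_Kv)⟩` (*"= ⟨B₁, C̃^{(j)}_ΛB₁⟩, where B₁ is equal to Q″*B everywhere except
the bonds of ⋃Ax(y)"* — the covariance kills the component orthogonal to `K`). [cite: Balaban1984PropagatorsII, (2.146) p.248] -/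
theorem inner_covOp_eq_proj (K : Submodule ℝ V) (S : V →ₗ[ℝ] V) (v : V) :
    ⟪v, covOp K S v⟫_ℝ = ⟪K.starProjection v, covOp K S (K.starProjection v)⟫_ℝ := by
  rw [covOp_apply, covOp_apply, covOpT_starProjection K S v]
  have h := Submodule.starProjection_inner_eq_zero v (K.subtype (covOpT K S (K.starProjection v))) (Submodule.coe_mem _)
  rw [inner_sub_left, sub_eq_zero] at h
  exact h

/-- hence **`⟨v, Cv⟩ ≥ U⁻¹‖P_Kv‖²`** for every `v`. [cite: Balaban1984PropagatorsII, (2.146)–(2.147) p.248] -/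
theorem inner_covOp_ge_proj (K : Submodule ℝ V) (S : V →ₗ[ℝ] V) (hS : ∀ x y : V, ⟪S x, y⟫_ℝ = ⟪x, S y⟫_ℝ)
    (hpos : ∀ k : ↥K, k ≠ 0 → 0 < ⟪(k : V), S k⟫_ℝ) {U : ℝ} (hU : 0 < U)
    (hup : ∀ k : ↥K, ⟪(k : V), S k⟫_ℝ ≤ U * ‖(k : V)‖ ^ 2) (v : V) :
    U⁻¹ * ‖K.starProjection v‖ ^ 2 ≤ ⟪v, covOp K S v⟫_ℝ := by
  rw [inner_covOp_eq_proj]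
  exact inner_covOp_ge_of_le K S hS hpos hU hup ⟨K.starProjection v, K.starProjection_apply_mem v⟩

end Cov

/-! ### The same for the derived Sect. C operators of `TwoScaleData` -/

section Abstract

open B6CovarianceOperator B6SectCOperators B6SectCOperators.TwoScaleData B6SectCPositivity

variable {A B W T Bs V : Type*}
  [NormedAddCommGroup A] [InnerProductSpace ℝ A] [FiniteDimensional ℝ A]
  [NormedAddCommGroup B] [InnerProductSpace ℝ B] [FiniteDimensional ℝ B]
  [NormedAddCommGroup W] [InnerProductSpace ℝ W] [FiniteDimensional ℝ W]
  [NormedAddCommGroup T] [InnerProductSpace ℝ T] [FiniteDimensional ℝ T]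
  [NormedAddCommGroup Bs] [InnerProductSpace ℝ Bs] [FiniteDimensional ℝ Bs]
  [NormedAddCommGroup V] [InnerProductSpace ℝ V] [FiniteDimensional ℝ V]
  {D : TwoScaleData A B W T Bs V}

/-- **`C̃^{(j)}_Λ ≥ U⁻¹` on the axial `B`** whenever the form (2.120) satisfies `⟨B, (Q″*aQ″ + Δ_j)B⟩ ≤ U‖B‖²` there (p. 248, for the
covariance `C̃^{(j)}_Λ = …TwoScaleData.Ct` of `…TwoScaleData.Sb` on `Ax`). [cite: Balaban1984PropagatorsII, p.248 (text after (2.146))] -/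
theorem inner_Ct_ge_of_Sb_le (hL : D.IsLattice) (hP : D.Positive) {U : ℝ} (hU : 0 < U)
    (hup : ∀ m : ↥D.Ax, ⟪(m : Bs), D.Sb m⟫_ℝ ≤ U * ‖(m : Bs)‖ ^ 2) (m : ↥D.Ax) :
    U⁻¹ * ‖(m : Bs)‖ ^ 2 ≤ ⟪(m : Bs), D.Ct m⟫_ℝ :=
  inner_covOp_ge_of_le D.Ax D.Sb (Sb_symm hL) (Sb_pos hL hP) hU hup m

/-- **(2.146)–(2.147) up to the `‖B₁‖²` step**: `⟨B, QGQ*B⟩ = ⟨Q″*B, C̃^{(j)}_ΛQ″*B⟩ ≥ U⁻¹‖P_{Ax}Q″*B‖²` (`P_{Ax}` the orthogonal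
projection onto the axial `B`; with *"‖B₁‖² ≥ const‖B‖²"* this is (2.147)). [cite: Balaban1984PropagatorsII, (2.147) p.248] -/
theorem ineq2147_of_Sb_le (hL : D.IsLattice) (hP : D.Positive) {U : ℝ} (hU : 0 < U)
    (hup : ∀ m : ↥D.Ax, ⟪(m : Bs), D.Sb m⟫_ℝ ≤ U * ‖(m : Bs)‖ ^ 2) (x : V) :
    U⁻¹ * ‖D.Ax.starProjection (LinearMap.adjoint D.Qpp x)‖ ^ 2 ≤ ⟪x, D.Q (D.G (LinearMap.adjoint D.Q x))⟫_ℝ := by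
  rw [B6Eq2146TwoScale.eq2146_printed hL hP x]
  exact inner_covOp_ge_proj D.Ax D.Sb (Sb_symm hL) (Sb_pos hL hP) hU hup _

/-- … and the full (2.147) shape with the `‖B₁‖²` step displayed (`hB1 : c_B‖B‖² ≤ ‖P_{Ax}Q″*B‖²`): `U⁻¹c_B‖B‖² ≤ ⟨B, QGQ*B⟩`.
[cite: Balaban1984PropagatorsII, (2.147) p.248] -/
theorem ineq2147_of_Sb_le_of_B1 (hL : D.IsLattice) (hP : D.Positive) {U : ℝ} (hU : 0 < U)
    (hup : ∀ m : ↥D.Ax, ⟪(m : Bs), D.Sb m⟫_ℝ ≤ U * ‖(m : Bs)‖ ^ 2) {cB : ℝ}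
    (hB1 : ∀ x : V, cB * ‖x‖ ^ 2 ≤ ‖D.Ax.starProjection (LinearMap.adjoint D.Qpp x)‖ ^ 2) (x : V) :
    U⁻¹ * cB * ‖x‖ ^ 2 ≤ ⟪x, D.Q (D.G (LinearMap.adjoint D.Q x))⟫_ℝ :=
  calc U⁻¹ * cB * ‖x‖ ^ 2 = U⁻¹ * (cB * ‖x‖ ^ 2) := by ring
    _ ≤ U⁻¹ * ‖D.Ax.starProjection (LinearMap.adjoint D.Qpp x)‖ ^ 2 := mul_le_mul_of_nonneg_left (hB1 x) (inv_nonneg.mpr hU.le)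
    _ ≤ _ := ineq2147_of_Sb_le hL hP hU hup x

end Abstract

/-! ## §2  V1 calculus, one level: `Σ_c |(Q₁B)(c)|² ≤ L^{−d}‖B‖²` for the bond average (1.11) -/

section OneLevel

open LatticeFieldCalculus

variable {P : Params} {j : ℕ}

/-- a sum over bonds is a double sum over sites and directions. [folklore] -/
private theorem sum_bond_eq {α : Type*} [AddCommMonoid α] (F : PBond P j → α) :
    ∑ b : PBond P j, F b = ∑ x : Site P j, ∑ μ : Fin P.d, F ⟨x, μ⟩ :=
  calc ∑ b : PBond P j, F b = ∑ p : Site P j × Fin P.d, F (bondEquiv p) := (Equiv.sum_comp (bondEquiv (P := P) (j := j)) F).symm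
    _ = ∑ x : Site P j, ∑ μ : Fin P.d, F ⟨x, μ⟩ := Fintype.sum_prod_type _

/-- a sum over the fine torus is the sum over blocks of the sums over block offsets (standing range). [folklore] -/
private theorem sum_blockSite' {α : Type*} [AddCommMonoid α] (hj : j + 1 ≤ P.m + P.K) (F : Site P j → α) :
    ∑ x, F x = ∑ y : Site P (j + 1), ∑ r : Fin P.d → Fin P.L, F (Site.blockSite y r) := by
  rw [← Finset.sum_fiberwise_of_maps_to (s := Finset.univ) (t := Finset.univ) (g := blockOf) (fun _ _ => Finset.mem_univ _) F]
  refine Finset.sum_congr rfl fun y _ => ?_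
  have hmem : ∀ x : Site P j, blockOf x = y ↔ x ∈ ({x ∈ Finset.univ | blockOf x = y} : Finset (Site P j)) := fun x => by simp
  let e : (Fin P.d → Fin P.L) ≃ ↥({x ∈ Finset.univ | blockOf x = y} : Finset (Site P j)) :=
    (Site.blockEquiv hj y).symm.trans (Equiv.subtypeEquivRight hmem)
  rw [← Finset.sum_coe_sort _ F, ← Equiv.sum_comp e (fun a => F a.1)]
  exact Finset.sum_congr rfl fun r _ => rfl

/-- translation invariance: `Σ_x g(x + t e_μ) = Σ_x g(x)` on the torus. [folklore] -/
private theorem sum_runSite (μ : Fin P.d) (t : ℕ) (g : Site P j → ℝ) : ∑ x, g (runSite x μ t) = ∑ x, g x := by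
  induction t generalizing g with
  | zero => simp
  | succ t ih =>
    simp_rw [runSite_succ]
    rw [ih (fun x => g (x.shift μ))]
    exact Equiv.sum_comp (shiftEquiv (P := P) (j := j) μ) g

/-- Jensen for one coarse bond: `|(QA)(c)|² ≤ L^{−(d+1)} Σ_{x∈B(c₋)} Σ_{t<L} |A(x + te_μ, μ)|²` ((1.11): `(QA)(c)` is the average of
the `L^{d+1}` bond values on the straight contours `[x, x(c)]`). [cite: Balaban1984PropagatorsI, (1.11) p.19] -/
theorem bondAvg_sq_le (B : VecField P j ℝ) (e : PBond P (j + 1)) :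
    bondAvg B e ^ 2 ≤ ((P.L : ℝ) ^ (P.d + 1))⁻¹ *
      ∑ r : Fin P.d → Fin P.L, ∑ t ∈ Finset.range P.L, B (runBond (Site.blockSite e.src r) e.dir t) ^ 2 := by
  have hL : (0 : ℝ) < P.L := Nat.cast_pos.2 P.L_pos
  have hLd : (0 : ℝ) < (P.L : ℝ) ^ (P.d + 1) := pow_pos hL _
  have h1 : (∑ r : Fin P.d → Fin P.L, ∑ t ∈ Finset.range P.L, B (runBond (Site.blockSite e.src r) e.dir t)) ^ 2
      ≤ (P.L : ℝ) ^ P.d * ∑ r : Fin P.d → Fin P.L, (∑ t ∈ Finset.range P.L, B (runBond (Site.blockSite e.src r) e.dir t)) ^ 2 := by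
    have h := sq_sum_le_card_mul_sum_sq (s := (Finset.univ : Finset (Fin P.d → Fin P.L)))
      (f := fun r => ∑ t ∈ Finset.range P.L, B (runBond (Site.blockSite e.src r) e.dir t))
    rwa [Finset.card_univ, Fintype.card_fun, Fintype.card_fin, Fintype.card_fin, Nat.cast_pow] at h
  have h2 : ∀ r : Fin P.d → Fin P.L, (∑ t ∈ Finset.range P.L, B (runBond (Site.blockSite e.src r) e.dir t)) ^ 2
      ≤ (P.L : ℝ) * ∑ t ∈ Finset.range P.L, B (runBond (Site.blockSite e.src r) e.dir t) ^ 2 := by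
    intro r
    have h := sq_sum_le_card_mul_sum_sq (s := Finset.range P.L) (f := fun t => B (runBond (Site.blockSite e.src r) e.dir t))
    rwa [Finset.card_range] at h
  have h3 : ∑ r : Fin P.d → Fin P.L, (∑ t ∈ Finset.range P.L, B (runBond (Site.blockSite e.src r) e.dir t)) ^ 2
      ≤ (P.L : ℝ) * ∑ r : Fin P.d → Fin P.L, ∑ t ∈ Finset.range P.L, B (runBond (Site.blockSite e.src r) e.dir t) ^ 2 := by
    rw [Finset.mul_sum]; exact Finset.sum_le_sum fun r _ => h2 r
  unfold bondAvg segSum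
  rw [smul_eq_mul, mul_pow]
  calc (((P.L : ℝ) ^ (P.d + 1))⁻¹) ^ 2 * (∑ r : Fin P.d → Fin P.L, ∑ t ∈ Finset.range P.L, B (runBond (Site.blockSite e.src r) e.dir t)) ^ 2
      ≤ (((P.L : ℝ) ^ (P.d + 1))⁻¹) ^ 2 * ((P.L : ℝ) ^ P.d * ((P.L : ℝ) *
          ∑ r : Fin P.d → Fin P.L, ∑ t ∈ Finset.range P.L, B (runBond (Site.blockSite e.src r) e.dir t) ^ 2)) := by
        gcongr
        exact h1.trans (mul_le_mul_of_nonneg_left h3 (by positivity))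
    _ = ((P.L : ℝ) ^ (P.d + 1))⁻¹ * ∑ r : Fin P.d → Fin P.L, ∑ t ∈ Finset.range P.L, B (runBond (Site.blockSite e.src r) e.dir t) ^ 2 := by
        field_simp
        ring

/-- **`Σ_c |(Q₁B)(c)|² ≤ L^{−d}‖B‖²`** — the one-level bond average (1.11) contracts the `ℓ²`-norm by `L^{−d/2}` (Jensen per coarse bond;
the blocks partition `T^{(j)}`; each of the `L` translates `x ↦ x + te_μ` preserves `Σ_x`). [cite: Balaban1984PropagatorsI, (1.11) p.19] -/
theorem sum_bondAvg_sq_le (hj : j + 1 ≤ P.m + P.K) (B : VecField P j ℝ) :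
    ∑ e : PBond P (j + 1), bondAvg B e ^ 2 ≤ ((P.L : ℝ) ^ P.d)⁻¹ * ∑ b : PBond P j, B b ^ 2 := by
  have hL : (0 : ℝ) < P.L := Nat.cast_pos.2 P.L_pos
  have key : ∀ μ : Fin P.d, ∑ y : Site P (j + 1), ∑ r : Fin P.d → Fin P.L, ∑ t ∈ Finset.range P.L,
      B ⟨runSite (Site.blockSite y r) μ t, μ⟩ ^ 2 = ∑ t ∈ Finset.range P.L, ∑ x : Site P j, B ⟨x, μ⟩ ^ 2 := by
    intro μ
    rw [← sum_blockSite' hj (fun x => ∑ t ∈ Finset.range P.L, B ⟨runSite x μ t, μ⟩ ^ 2), Finset.sum_comm]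
    exact Finset.sum_congr rfl fun t _ => sum_runSite μ t (fun x => B ⟨x, μ⟩ ^ 2)
  calc ∑ e : PBond P (j + 1), bondAvg B e ^ 2
      ≤ ∑ e : PBond P (j + 1), ((P.L : ℝ) ^ (P.d + 1))⁻¹ *
          ∑ r : Fin P.d → Fin P.L, ∑ t ∈ Finset.range P.L, B (runBond (Site.blockSite e.src r) e.dir t) ^ 2 :=
        Finset.sum_le_sum fun e _ => bondAvg_sq_le B e
    _ = ((P.L : ℝ) ^ (P.d + 1))⁻¹ * ∑ μ : Fin P.d, ∑ t ∈ Finset.range P.L, ∑ x : Site P j, B ⟨x, μ⟩ ^ 2 := by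
        rw [← Finset.mul_sum, sum_bond_eq, Finset.sum_comm]
        simp only [runBond, key]
    _ = ((P.L : ℝ) ^ (P.d + 1))⁻¹ * ((P.L : ℝ) * ∑ b : PBond P j, B b ^ 2) := by
        congr 1
        simp only [Finset.sum_const, Finset.card_range, nsmul_eq_mul]
        rw [← Finset.mul_sum, sum_bond_eq, Finset.sum_comm]
    _ = ((P.L : ℝ) ^ P.d)⁻¹ * ∑ b : PBond P j, B b ^ 2 := by
        rw [pow_succ]
        field_simp

end OneLevel

/-! ## §3  For `tsV1`: the upper bound of the form (2.120), `C̃^{(j)}_Λ ≥ U⁻¹` on the axial `B`, and (2.147) up to `‖B₁‖²` -/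

section TwoScale

open B6SectCOperators B6SectCOperators.TwoScaleData B6SectCTwoScaleV1 B6SectCTwoScaleV1Lattice LatticeFieldCalculus
open B5SectBStatements (eta)
open Beta.Ineq167OperatorUpper (gamma1 gamma1_pos)
open B6Ineq2118TwoScaleV1 (kappa_pos const_nonneg inner_Sb_le_V1)

variable {P : Params} {c : ℝ} (hc : c ≠ 0) {j : ℕ} (hj : j + 1 ≤ P.m + P.K) (Λ' : Finset (Site P (j + 1)))
  {w : CIdx j Λ' → ℝ} (hw : ∀ i, 0 < w i) {W : ℝ} (hW0 : 0 ≤ W) (hW : ∀ i, w i ≤ W)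

/-- a sum of squares over a subtype is at most the full sum. [folklore] -/
private theorem sum_subtype_sq_le {ι : Type*} [Fintype ι] (p : ι → Prop) [DecidablePred p] (f : ι → ℝ) :
    ∑ i : {x // p x}, f i ^ 2 ≤ ∑ i, f i ^ 2 := by
  rw [← Fintype.sum_subtype_add_sum_subtype p (fun i => f i ^ 2)]
  have h : 0 ≤ ∑ i : {x // ¬p x}, f i ^ 2 := Finset.sum_nonneg fun _ _ => sq_nonneg _
  linarith

include hj hW0 hW in
/-- **`⟨Q″B, aQ″B⟩ ≤ W(1 + L^{−d})‖B‖²`** for weights `w ≤ W`: the `Λ^c`-bonds contribute `≤ W‖B↾‖²`, the `Λ′`-bonds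
`≤ W Σ_c|(Q₁B)(c)|² ≤ WL^{−d}‖B‖²` (§2). [cite: Balaban1984PropagatorsII, (2.120) p.244] -/
theorem inner_Qpp_a_le (b : UBond P j) :
    ⟪Qpp P j Λ' b, aW P j Λ' w (Qpp P j Λ' b)⟫_ℝ ≤ W * (1 + ((P.L : ℝ) ^ P.d)⁻¹) * ‖b‖ ^ 2 := by
  have h1 : ⟪Qpp P j Λ' b, aW P j Λ' w (Qpp P j Λ' b)⟫_ℝ = ∑ i, w i * Qpp P j Λ' b i ^ 2 := by
    rw [PiLp.inner_apply]
    refine Finset.sum_congr rfl fun i _ => ?_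
    rw [aW_apply]
    simp only [RCLike.inner_apply, conj_trivial]
    ring
  have h2 : ∑ i, w i * Qpp P j Λ' b i ^ 2 ≤ W * ∑ i, Qpp P j Λ' b i ^ 2 := by
    rw [Finset.mul_sum]
    exact Finset.sum_le_sum fun i _ => mul_le_mul_of_nonneg_right (hW i) (sq_nonneg _)
  have h3 : ∑ i, Qpp P j Λ' b i ^ 2 =
      ∑ o : OutBond j Λ', b o.1 ^ 2 + ∑ e : InBond j Λ', bondAvg (WithLp.ofLp b) e.1 ^ 2 := by
    rw [Fintype.sum_sum_type]
    rfl
  have h4 : ∑ o : OutBond j Λ', b o.1 ^ 2 ≤ ∑ bb : PBond P j, b bb ^ 2 :=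
    sum_subtype_sq_le (fun bb : PBond P j => blockOf bb.src ∉ Λ' ∧ blockOf bb.tgt ∉ Λ') (fun bb => b bb)
  have h5 : ∑ e : InBond j Λ', bondAvg (WithLp.ofLp b) e.1 ^ 2 ≤ ∑ e : PBond P (j + 1), bondAvg (WithLp.ofLp b) e ^ 2 :=
    sum_subtype_sq_le (fun e : PBond P (j + 1) => e.src ∈ Λ' ∨ e.tgt ∈ Λ') (fun e => bondAvg (WithLp.ofLp b) e)
  have h6 := sum_bondAvg_sq_le hj (WithLp.ofLp b)
  have hn : ∑ bb : PBond P j, b bb ^ 2 = ‖b‖ ^ 2 := by rw [EuclideanSpace.real_norm_sq_eq]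
  have hn' : ∑ bb : PBond P j, WithLp.ofLp b bb ^ 2 = ‖b‖ ^ 2 := hn
  rw [hn'] at h6
  have h7 : ∑ i, Qpp P j Λ' b i ^ 2 ≤ (1 + ((P.L : ℝ) ^ P.d)⁻¹) * ‖b‖ ^ 2 := by
    rw [h3, add_mul, one_mul]
    linarith
  rw [h1]
  calc ∑ i, w i * Qpp P j Λ' b i ^ 2 ≤ W * ∑ i, Qpp P j Λ' b i ^ 2 := h2
    _ ≤ W * ((1 + ((P.L : ℝ) ^ P.d)⁻¹) * ‖b‖ ^ 2) := mul_le_mul_of_nonneg_left h7 hW0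
    _ = W * (1 + ((P.L : ℝ) ^ P.d)⁻¹) * ‖b‖ ^ 2 := by ring

include hc hW0 in
/-- `0 < U = W(1 + L^{−d}) + 8dγ₁κ` (`d ≥ 1`, `κ > 0`, `γ₁ > 0`). [cite: Balaban1984PropagatorsII, (2.147) p.248] -/
theorem U_pos : 0 < W * (1 + ((P.L : ℝ) ^ P.d)⁻¹) +
    c ^ 2 / (eta P.L j ^ P.d * ((P.L : ℝ) ^ j) ^ 2) * (gamma1 P.d * (8 * P.d)) := by
  have h1 : 0 ≤ W * (1 + ((P.L : ℝ) ^ P.d)⁻¹) := by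
    have : (0 : ℝ) < (P.L : ℝ) ^ P.d := pow_pos (Nat.cast_pos.2 P.L_pos) _
    positivity
  have h2 : 0 < c ^ 2 / (eta P.L j ^ P.d * ((P.L : ℝ) ^ j) ^ 2) * (gamma1 P.d * (8 * P.d)) := by
    have hκ := kappa_pos (P := P) hc (j := j)
    have hγ := gamma1_pos P.d
    have hd : (0 : ℝ) < P.d := Nat.cast_pos.2 P.hd
    positivity
  linarith

include hj hw hW0 hW

/-- **the form (2.120) is bounded from above UNIFORMLY for `tsV1`**: `⟨B, (Q″*aQ″ + Δ_j)B⟩ ≤ U‖B‖²`, `U = W(1 + L^{−d}) + 8dγ₁κ`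
(`…B6Ineq2118TwoScaleV1.inner_Sb_le_V1` + `inner_Qpp_a_le`). [cite: Balaban1984PropagatorsII, (2.120) p.244] -/
theorem inner_Sb_le_V1_unif (b : UBond P j) :
    ⟪b, (tsV1 hc Λ' w).Sb b⟫_ℝ ≤ (W * (1 + ((P.L : ℝ) ^ P.d)⁻¹) +
      c ^ 2 / (eta P.L j ^ P.d * ((P.L : ℝ) ^ j) ^ 2) * (gamma1 P.d * (8 * P.d))) * ‖b‖ ^ 2 := by
  have h1 := inner_Sb_le_V1 hc hj Λ' hw b
  have h2 : ⟪(tsV1 hc Λ' w).Qpp b, (tsV1 hc Λ' w).a ((tsV1 hc Λ' w).Qpp b)⟫_ℝ ≤ W * (1 + ((P.L : ℝ) ^ P.d)⁻¹) * ‖b‖ ^ 2 :=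
    inner_Qpp_a_le hj Λ' hW0 hW b
  rw [add_mul]
  linarith

/-- **p. 248 FOR `tsV1`, UNCONDITIONALLY: `C̃^{(j)}_Λ ≥ U⁻¹` on the axial `B`** — `U⁻¹‖B‖² ≤ ⟨B, C̃^{(j)}_ΛB⟩` for every `B` in the block
axial gauge on `Λ′`, `U = W(1 + L^{−d}) + 8dγ₁κ` (gen 3's displayed `hupper` discharged for the concrete model).
[cite: Balaban1984PropagatorsII, p.248 (text after (2.146))] -/
theorem inner_Ct_ge_V1 (m : ↥(tsV1 hc Λ' w).Ax) :
    (W * (1 + ((P.L : ℝ) ^ P.d)⁻¹) + c ^ 2 / (eta P.L j ^ P.d * ((P.L : ℝ) ^ j) ^ 2) * (gamma1 P.d * (8 * P.d)))⁻¹ *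
        ‖(m : UBond P j)‖ ^ 2 ≤ ⟪(m : UBond P j), (tsV1 hc Λ' w).Ct m⟫_ℝ :=
  inner_Ct_ge_of_Sb_le (isLattice Λ' hc hj hw) (positive Λ' hc hj w) (U_pos hc hW0) (fun m => inner_Sb_le_V1_unif hc hj Λ' hw hW0 hW m) m

/-- **(2.146)–(2.147) FOR `tsV1` up to the `‖B₁‖²` step**: `⟨B, QGQ*B⟩ ≥ U⁻¹‖P_{Ax}Q″*B‖²` for every `B` on `𝔅 = Λ^c ∪ Λ′`
(`Q = Q″Q_j`, `G = Δ_a⁻¹` of (2.95), `P_{Ax}` the orthogonal projection onto the block axial gauge — the typed `B₁`).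
[cite: Balaban1984PropagatorsII, (2.147) p.248] -/
theorem ineq2147_V1_B1 (x : CSpace j Λ') :
    (W * (1 + ((P.L : ℝ) ^ P.d)⁻¹) + c ^ 2 / (eta P.L j ^ P.d * ((P.L : ℝ) ^ j) ^ 2) * (gamma1 P.d * (8 * P.d)))⁻¹ *
        ‖(tsV1 hc Λ' w).Ax.starProjection (LinearMap.adjoint (tsV1 hc Λ' w).Qpp x)‖ ^ 2 ≤
      ⟪x, (tsV1 hc Λ' w).Q ((tsV1 hc Λ' w).G (LinearMap.adjoint (tsV1 hc Λ' w).Q x))⟫_ℝ :=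
  ineq2147_of_Sb_le (isLattice Λ' hc hj hw) (positive Λ' hc hj w) (U_pos hc hW0) (fun m => inner_Sb_le_V1_unif hc hj Λ' hw hW0 hW m) x

/-- **(2.147) FOR `tsV1` with the single printed step displayed**: if *"‖B₁‖² is bounded from below by const‖B‖²"*
(`hB1 : c_B‖B‖² ≤ ‖P_{Ax}Q″*B‖²`), then `γ₀‖B‖² ≤ ⟨B, QGQ*B⟩` with `γ₀ = U⁻¹c_B` explicit in `d, L, j, c, W`.
[cite: Balaban1984PropagatorsII, (2.147) p.248] -/
theorem ineq2147_V1_of_B1 {cB : ℝ}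
    (hB1 : ∀ x : CSpace j Λ', cB * ‖x‖ ^ 2 ≤ ‖(tsV1 hc Λ' w).Ax.starProjection (LinearMap.adjoint (tsV1 hc Λ' w).Qpp x)‖ ^ 2)
    (x : CSpace j Λ') :
    (W * (1 + ((P.L : ℝ) ^ P.d)⁻¹) + c ^ 2 / (eta P.L j ^ P.d * ((P.L : ℝ) ^ j) ^ 2) * (gamma1 P.d * (8 * P.d)))⁻¹ * cB *
        ‖x‖ ^ 2 ≤ ⟪x, (tsV1 hc Λ' w).Q ((tsV1 hc Λ' w).G (LinearMap.adjoint (tsV1 hc Λ' w).Q x))⟫_ℝ :=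
  ineq2147_of_Sb_le_of_B1 (isLattice Λ' hc hj hw) (positive Λ' hc hj w) (U_pos hc hW0)
    (fun m => inner_Sb_le_V1_unif hc hj Λ' hw hW0 hW m) hB1 x

end TwoScale

end Literature.MathematicalPhysics.QuantumFieldTheory.Balaban1983to89.B6Ineq2147TwoScaleV1

end
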